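import Literature.NumberTheory.Rogawski1990.CartanIndex   -- ★ `exists_ne_zero_map_eq_neg` (a non-zero skew scalar), `cartanInvolution` (the consumer's `τ`)
import Mathlib.Algebra.Algebra.Subalgebra.Basic
import Mathlib.Algebra.Algebra.Tower
import HarnessLib

/-!
# Descent for an algebra with a semilinear involution over a quadratic extension: an `F`-isomorphism of the fixed algebras `B^τ ≅ B′^{τ′}` extends to an
# `L`-isomorphism `(B, τ) ≅ (B′, τ′)` (Rogawski 1990, §3.5 p. 29: `L[γ] = K ⊗_F E`, `K = L[γ]^⋆`; Bourbaki A.V §10 no. 4, Galois descent for `[L : F] = 2`)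

Topic `NumberTheory/Rogawski1990`; namespace `Literature.NumberTheory.Rogawski1990`.  THEOREMS ONLY (no definition, no instance, no notation, no named fact, no
`sorry`); universe `Type` (the letters of ★ `CartanIndex`).  Cell `pub/hodgecm-mathlib`, crux H413 = `stmt-HodgeConjecture-24833` (supports-only lane), line LH6 «StCharTS», (S-𝔇) datum road,
brick (B4) «CARTAN-ALGEBRA-DESCENT» of the p03 lineage's «CARTAN-FIN (N1)» road: the Cartan algebra `(L[γ], ⋆)` of a regular element of `U(H)(F)` is determined, as an
`L`-algebra WITH INVOLUTION, by the étale `F`-algebra `K = L[γ]^⋆` — so finitely many `K` (brick (B2)) give finitely many stable classes of Cartan subgroups ((B3), (B5)).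

THE MATHEMATICS.  `L ⊇ F` fields, `σ : L → L` a ring endomorphism fixing `F` with `σ² = 1`, FIXED FIELD EXACTLY `F` (`σ x = x ⇒ x ∈ F`), `2 ≠ 0`, `σ ≠ 1`; pick
`ε ∈ L` with `σ ε = −ε ≠ 0` (`exists_ne_zero_map_eq_neg_of_involutive`), so `ε² ∈ F` and `L = F ⊕ F ε`.  Let `B` be a commutative `L`-algebra with an `F`-algebra involution `τ` that is
`σ`-SEMILINEAR (`τ(ℓ b) = σ(ℓ) τ(b)`), `K := B^τ` (Mathlib `AlgHom.equalizer τ id`).  Every `b` decomposes UNIQUELY as `b = x + ε y` with `x, y ∈ K`: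
`x = ½(b + τb)`, `y = (2ε)⁻¹(b − τb)` (§1: `tau_half_add`, `tau_half_sub`, `half_add_add_eps_smul`, uniqueness `half_add_eq_of_fixed` ∕ `half_sub_eq_of_fixed`).
Hence (§2) for commutative `L`-algebras with such involutions `(B, τ)`, `(B′, τ′)` and an `F`-algebra isomorphism `ψ₀ : B^τ ≃ B′^{τ′}`, the map
`Ψ(x + ε y) := ψ₀ x + ε ψ₀ y` is an `L`-ALGEBRA ISOMORPHISM `B ≃ₐ[L] B′` with `Ψ ∘ τ = τ′ ∘ Ψ` extending `ψ₀`: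
**`exists_algEquiv_extending_fixed_algEquiv`** (multiplicativity: `(x₁ + εy₁)(x₂ + εy₂) = (x₁x₂ + ε²y₁y₂) + ε(x₁y₂ + y₁x₂)` with `ε² ∈ F`; `L`-linearity: `ℓ = f + gε`,
`f, g ∈ F`).  Consumer: the Cartan algebras `B = L[γ] ⊆ M_N(L)` with `τ = ⋆|_{L[γ]}` (★ `CartanIndex.cartanInvolution`, semilinear by ★ `hermStar_smul`), (B7) of the road.
HC_CM is proved only modulo the printed citations until rung 0 closes; this file is unconditional algebra (count-neutral).

## References
* [Rogawski1990] J. D. Rogawski, *Automorphic Representations of Unitary Groups in Three Variables*, Ann. of Math. Stud. 123 (1990), §3.5 p. 29 (`L′ = L[γ] = K ⊗ E`,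
  `K` the fixed algebra of the adjoint involution), §3.6 p. 31.
* [BourbakiAlgebra] N. Bourbaki, *Algèbre*, Ch. V §10 no. 4 (descente galoisienne), Ch. VIII (semi-linear maps).
-/

set_option autoImplicit false

namespace Literature.NumberTheory.Rogawski1990

section Skew

variable {F L : Type} [Field F] [Field L] [Algebra F L] (σ : L →+* L)

/-- `σ` fixes `2⁻¹`. [cite: Rogawski1990, §3.5 p. 29] -/
theorem ringHom_map_inv_two (σ : L →+* L) : σ (2 : L)⁻¹ = (2 : L)⁻¹ := by
  rw [map_inv₀, map_ofNat]

/-- `σ((2ε)⁻¹) = −(2ε)⁻¹` for `σ ε = −ε`. [cite: Rogawski1990, §3.5 p. 29] -/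
theorem ringHom_map_inv_two_mul_skew {ε : L} (hε : σ ε = -ε) : σ (2 * ε)⁻¹ = -(2 * ε)⁻¹ := by
  rw [map_inv₀, map_mul, map_ofNat, hε, mul_neg, inv_neg]

/-- A `σ`-fixed element lies in `F` when the fixed field is `F`: packaged `smul` form — `x • b = q • b` for the descended `q ∈ F`.
[cite: Rogawski1990, §3.5 p. 29] -/
theorem exists_smul_eq_smul_of_fixed (hFix : ∀ x : L, σ x = x → ∃ q : F, algebraMap F L q = x) {x : L} (hx : σ x = x)
    {B : Type} [CommRing B] [Algebra L B] [Algebra F B] [IsScalarTower F L B] :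
    ∃ q : F, algebraMap F L q = x ∧ ∀ b : B, x • b = q • b := by
  obtain ⟨q, hq⟩ := hFix x hx
  exact ⟨q, hq, fun b => by rw [← hq, algebraMap_smul]⟩

end Skew

section Parts

variable {F L : Type} [Field F] [Field L] (σ : L →+* L)
variable {B : Type} [CommRing B] [Algebra L B] [Algebra F B]
variable (τ : B ≃ₐ[F] B)

/-! ## §1 The decomposition `b = ½(b + τb) + ε · (2ε)⁻¹(b − τb)` into `τ`-fixed parts -/

/-- `½(b + τ b)` is `τ`-fixed. [cite: Rogawski1990, §3.5 p. 29] -/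
theorem tau_half_add (hτ : ∀ (ℓ : L) (b : B), τ (ℓ • b) = σ ℓ • τ b) (hττ : ∀ b : B, τ (τ b) = b) (b : B) :
    τ ((2 : L)⁻¹ • (b + τ b)) = (2 : L)⁻¹ • (b + τ b) := by
  rw [hτ, ringHom_map_inv_two, map_add, hττ, add_comm]

/-- `(2ε)⁻¹(b − τ b)` is `τ`-fixed (`σ ε = −ε`). [cite: Rogawski1990, §3.5 p. 29] -/
theorem tau_half_sub (hτ : ∀ (ℓ : L) (b : B), τ (ℓ • b) = σ ℓ • τ b) (hττ : ∀ b : B, τ (τ b) = b) {ε : L} (hε : σ ε = -ε) (b : B) :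
    τ ((2 * ε)⁻¹ • (b - τ b)) = (2 * ε)⁻¹ • (b - τ b) := by
  rw [hτ, ringHom_map_inv_two_mul_skew σ hε, map_sub, hττ, neg_smul, ← smul_neg, neg_sub]

/-- Recomposition: `½(b + τb) + ε·(2ε)⁻¹(b − τb) = b` (`2 ≠ 0`, `ε ≠ 0`). [cite: Rogawski1990, §3.5 p. 29] -/
theorem half_add_add_eps_smul (h2 : (2 : L) ≠ 0) {ε : L} (hε0 : ε ≠ 0) (b : B) :
    (2 : L)⁻¹ • (b + τ b) + ε • ((2 * ε)⁻¹ • (b - τ b)) = b := by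
  rw [smul_smul, mul_inv_rev, ← mul_assoc, mul_inv_cancel₀ hε0, one_mul, smul_add, smul_sub, add_add_sub_cancel, ← add_smul,
    ← two_mul, mul_inv_cancel₀ h2, one_smul]

/-- Uniqueness of the fixed part: if `τ x = x`, `τ y = y` then `½((x + εy) + τ(x + εy)) = x`. [cite: Rogawski1990, §3.5 p. 29] -/
theorem half_add_eq_of_fixed (hτ : ∀ (ℓ : L) (b : B), τ (ℓ • b) = σ ℓ • τ b) (h2 : (2 : L) ≠ 0) {ε : L} (hε : σ ε = -ε) {x y : B}
    (hx : τ x = x) (hy : τ y = y) :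
    (2 : L)⁻¹ • ((x + ε • y) + τ (x + ε • y)) = x := by
  rw [map_add, hτ, hx, hy, hε, neg_smul, add_add_add_comm, add_neg_cancel, add_zero, ← two_smul L, smul_smul, inv_mul_cancel₀ h2, one_smul]

/-- Uniqueness of the skew part: if `τ x = x`, `τ y = y` then `(2ε)⁻¹((x + εy) − τ(x + εy)) = y`. [cite: Rogawski1990, §3.5 p. 29] -/
theorem half_sub_eq_of_fixed (hτ : ∀ (ℓ : L) (b : B), τ (ℓ • b) = σ ℓ • τ b) (h2 : (2 : L) ≠ 0) {ε : L} (hε : σ ε = -ε) (hε0 : ε ≠ 0) {x y : B}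
    (hx : τ x = x) (hy : τ y = y) :
    (2 * ε)⁻¹ • ((x + ε • y) - τ (x + ε • y)) = y := by
  rw [map_add, hτ, hx, hy, hε, neg_smul, add_sub_add_left_eq_sub, sub_neg_eq_add, ← two_smul L, smul_smul, smul_smul, mul_assoc,
    inv_mul_cancel₀ (mul_ne_zero h2 hε0), one_smul]

/-- `τ(ε² • z) = ε² • τ z` (`σ(ε²) = ε²`). [cite: Rogawski1990, §3.5 p. 29] -/
theorem tau_eps_sq_smul (hτ : ∀ (ℓ : L) (b : B), τ (ℓ • b) = σ ℓ • τ b) {ε : L} (hε : σ ε = -ε) (z : B) :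
    τ ((ε * ε) • z) = (ε * ε) • τ z := by
  rw [hτ, map_mul, hε, neg_mul_neg]

end Parts

section Main

variable {F L : Type} [Field F] [Field L] [Algebra F L] (σ : L →+* L)
variable {B : Type} [CommRing B] [Algebra L B] [Algebra F B] [IsScalarTower F L B]
variable {B' : Type} [CommRing B'] [Algebra L B'] [Algebra F B'] [IsScalarTower F L B']
variable (τ : B ≃ₐ[F] B) (τ' : B' ≃ₐ[F] B')

/-! ## §2 The descended map `Ψ(x + εy) = ψ₀ x + ε ψ₀ y` -/

/-- **Existence of an `L`-algebra HOMOMORPHISM extending `ψ₀ : B^τ → B′^{τ′}` and intertwining the involutions**, given by the formula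
`Ψ b = ψ₀(½(b + τb)) + ε · ψ₀((2ε)⁻¹(b − τb))`. [cite: Rogawski1990, §3.5 p. 29] -/
theorem exists_algHom_extending_fixed_algHom (hσσ : ∀ x : L, σ (σ x) = x)
    (hFix : ∀ x : L, σ x = x → ∃ q : F, algebraMap F L q = x) (h2 : (2 : L) ≠ 0) {ε : L} (hε0 : ε ≠ 0) (hε : σ ε = -ε)
    (hτ : ∀ (ℓ : L) (b : B), τ (ℓ • b) = σ ℓ • τ b) (hττ : ∀ b : B, τ (τ b) = b)
    (hτ' : ∀ (ℓ : L) (b : B'), τ' (ℓ • b) = σ ℓ • τ' b)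
    (ψ₀ : ↥(AlgHom.equalizer (τ : B →ₐ[F] B) (AlgHom.id F B)) →ₐ[F] ↥(AlgHom.equalizer (τ' : B' →ₐ[F] B') (AlgHom.id F B'))) :
    ∃ Ψ : B →ₐ[L] B',
      (∀ b : B, Ψ b = (ψ₀ ⟨(2 : L)⁻¹ • (b + τ b), (tau_half_add σ τ hτ hττ b)⟩ : B') + ε • (ψ₀ ⟨(2 * ε)⁻¹ • (b - τ b), (tau_half_sub σ τ hτ hττ hε b)⟩ : B')) ∧
      (∀ b : B, Ψ (τ b) = τ' (Ψ b)) ∧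
      (∀ x : ↥(AlgHom.equalizer (τ : B →ₐ[F] B) (AlgHom.id F B)), Ψ (x : B) = (ψ₀ x : B')) := by
  -- fixed parts as elements of `K = B^τ`
  let P : B → ↥(AlgHom.equalizer (τ : B →ₐ[F] B) (AlgHom.id F B)) := fun b => ⟨(2 : L)⁻¹ • (b + τ b), tau_half_add σ τ hτ hττ b⟩
  let Q : B → ↥(AlgHom.equalizer (τ : B →ₐ[F] B) (AlgHom.id F B)) := fun b => ⟨(2 * ε)⁻¹ • (b - τ b), tau_half_sub σ τ hτ hττ hε b⟩
  have hPQ : ∀ b : B, (P b : B) + ε • (Q b : B) = b := fun b => half_add_add_eps_smul τ h2 hε0 b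
  -- uniqueness: the parts of `x + ε y` (`x, y ∈ K`)
  have hPfix : ∀ x y : ↥(AlgHom.equalizer (τ : B →ₐ[F] B) (AlgHom.id F B)), P ((x : B) + ε • (y : B)) = x := fun x y =>
    Subtype.ext (half_add_eq_of_fixed σ τ hτ h2 hε x.2 y.2)
  have hQfix : ∀ x y : ↥(AlgHom.equalizer (τ : B →ₐ[F] B) (AlgHom.id F B)), Q ((x : B) + ε • (y : B)) = y := fun x y =>
    Subtype.ext (half_sub_eq_of_fixed σ τ hτ h2 hε hε0 x.2 y.2)
  -- `ε² ∈ F`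
  obtain ⟨e, he, hesmul⟩ := exists_smul_eq_smul_of_fixed σ hFix (show σ (ε * ε) = ε * ε by rw [map_mul, hε, neg_mul_neg]) (B := B)
  obtain ⟨e', he', hesmul'⟩ := exists_smul_eq_smul_of_fixed σ hFix (show σ (ε * ε) = ε * ε by rw [map_mul, hε, neg_mul_neg]) (B := B')
  have hee' : e' = e := (algebraMap F L).injective (he'.trans he.symm)
  rw [hee'] at hesmul'
  -- values in `B'` of fixed elements are fixed
  have hψfix : ∀ x : ↥(AlgHom.equalizer (τ : B →ₐ[F] B) (AlgHom.id F B)), τ' (ψ₀ x : B') = (ψ₀ x : B') := fun x => (ψ₀ x).2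
  -- the map
  let f : B → B' := fun b => (ψ₀ (P b) : B') + ε • (ψ₀ (Q b) : B')
  -- products: parts of `b₁ b₂`
  have hPmul : ∀ b₁ b₂ : B, P (b₁ * b₂) = P b₁ * P b₂ + e • (Q b₁ * Q b₂) := by
    intro b₁ b₂
    have hx : ((P b₁ * P b₂ + e • (Q b₁ * Q b₂) : ↥(AlgHom.equalizer (τ : B →ₐ[F] B) (AlgHom.id F B))) : B) + ε • ((P b₁ * Q b₂ + Q b₁ * P b₂ : ↥(AlgHom.equalizer (τ : B →ₐ[F] B) (AlgHom.id F B))) : B) = b₁ * b₂ := by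
      conv_rhs => rw [← hPQ b₁, ← hPQ b₂]
      simp only [Subalgebra.coe_add, Subalgebra.coe_mul, Subalgebra.coe_smul]
      rw [← hesmul, Algebra.smul_def, Algebra.smul_def, Algebra.smul_def, Algebra.smul_def, map_mul]
      ring
    rw [← hx, hPfix]
  have hQmul : ∀ b₁ b₂ : B, Q (b₁ * b₂) = P b₁ * Q b₂ + Q b₁ * P b₂ := by
    intro b₁ b₂
    have hx : ((P b₁ * P b₂ + e • (Q b₁ * Q b₂) : ↥(AlgHom.equalizer (τ : B →ₐ[F] B) (AlgHom.id F B))) : B) + ε • ((P b₁ * Q b₂ + Q b₁ * P b₂ : ↥(AlgHom.equalizer (τ : B →ₐ[F] B) (AlgHom.id F B))) : B) = b₁ * b₂ := by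
      conv_rhs => rw [← hPQ b₁, ← hPQ b₂]
      simp only [Subalgebra.coe_add, Subalgebra.coe_mul, Subalgebra.coe_smul]
      rw [← hesmul, Algebra.smul_def, Algebra.smul_def, Algebra.smul_def, Algebra.smul_def, map_mul]
      ring
    rw [← hx, hQfix]
  -- scalars: parts of `ℓ • b` for `ℓ = u + ε v`, `u, v` fixed
  have hPone : P 1 = 1 := by
    have hx : ((1 : ↥(AlgHom.equalizer (τ : B →ₐ[F] B) (AlgHom.id F B))) : B) + ε • ((0 : ↥(AlgHom.equalizer (τ : B →ₐ[F] B) (AlgHom.id F B))) : B) = 1 := by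
      simp
    rw [← hx, hPfix]
  have hQone : Q 1 = 0 := by
    have hx : ((1 : ↥(AlgHom.equalizer (τ : B →ₐ[F] B) (AlgHom.id F B))) : B) + ε • ((0 : ↥(AlgHom.equalizer (τ : B →ₐ[F] B) (AlgHom.id F B))) : B) = 1 := by
      simp
    rw [← hx, hQfix]
  have hf_mul : ∀ b₁ b₂ : B, f (b₁ * b₂) = f b₁ * f b₂ := by
    intro b₁ b₂
    simp only [f, hPmul, hQmul, map_add, map_mul, map_smul, Subalgebra.coe_add, Subalgebra.coe_mul, Subalgebra.coe_smul]
    rw [← hesmul', Algebra.smul_def, Algebra.smul_def, Algebra.smul_def, Algebra.smul_def, map_mul]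
    ring
  have hf_add : ∀ b₁ b₂ : B, f (b₁ + b₂) = f b₁ + f b₂ := by
    intro b₁ b₂
    have hP : P (b₁ + b₂) = P b₁ + P b₂ := Subtype.ext (by simp only [P, Subalgebra.coe_add, map_add]; rw [← smul_add]; congr 1; abel)
    have hQ : Q (b₁ + b₂) = Q b₁ + Q b₂ := Subtype.ext (by simp only [Q, Subalgebra.coe_add, map_add]; rw [← smul_add]; congr 1; abel)
    simp only [f, hP, hQ, map_add, Subalgebra.coe_add, smul_add]
    abel
  have hf_one : f 1 = 1 := by simp only [f, hPone, hQone, map_one, map_zero, Subalgebra.coe_one, Subalgebra.coe_zero, smul_zero, add_zero]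
  -- `L`-linearity on scalars `ℓ = u + ε v`
  have hf_smul : ∀ (ℓ : L) (b : B), f (ℓ • b) = ℓ • f b := by
    intro ℓ b
    -- `u = ½(ℓ + σℓ)`, `v = (2ε)⁻¹(ℓ − σℓ)` are fixed
    have hu : σ ((2 : L)⁻¹ * (ℓ + σ ℓ)) = (2 : L)⁻¹ * (ℓ + σ ℓ) := by rw [map_mul, ringHom_map_inv_two, map_add, hσσ, add_comm]
    have hv : σ ((2 * ε)⁻¹ * (ℓ - σ ℓ)) = (2 * ε)⁻¹ * (ℓ - σ ℓ) := by
      rw [map_mul, ringHom_map_inv_two_mul_skew σ hε, map_sub, hσσ, neg_mul, ← mul_neg, neg_sub]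
    have hℓ : (2 : L)⁻¹ * (ℓ + σ ℓ) + ε * ((2 * ε)⁻¹ * (ℓ - σ ℓ)) = ℓ := by
      rw [mul_inv_rev, ← mul_assoc, ← mul_assoc, mul_inv_cancel₀ hε0, one_mul]
      have : (2 : L)⁻¹ * (ℓ + σ ℓ) + (2 : L)⁻¹ * (ℓ - σ ℓ) = (2 : L)⁻¹ * (2 * ℓ) := by ring
      rw [this, ← mul_assoc, inv_mul_cancel₀ h2, one_mul]
    obtain ⟨u, hu1, hus⟩ := exists_smul_eq_smul_of_fixed σ hFix hu (B := B)
    obtain ⟨u', hu1', hus'⟩ := exists_smul_eq_smul_of_fixed σ hFix hu (B := B')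
    obtain ⟨v, hv1, hvs⟩ := exists_smul_eq_smul_of_fixed σ hFix hv (B := B)
    obtain ⟨v', hv1', hvs'⟩ := exists_smul_eq_smul_of_fixed σ hFix hv (B := B')
    have huu' : u' = u := (algebraMap F L).injective (hu1'.trans hu1.symm)
    have hvv' : v' = v := (algebraMap F L).injective (hv1'.trans hv1.symm)
    rw [huu'] at hus'; rw [hvv'] at hvs'
    -- parts of `ℓ • b`: `x = u P + (ε² v) Q`, `y = v P + u Q`
    have hx : ((u • P b + (e * v) • Q b : ↥(AlgHom.equalizer (τ : B →ₐ[F] B) (AlgHom.id F B))) : B) +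
        ε • ((v • P b + u • Q b : ↥(AlgHom.equalizer (τ : B →ₐ[F] B) (AlgHom.id F B))) : B) = ℓ • b := by
      conv_rhs => rw [← hPQ b, ← hℓ]
      simp only [Subalgebra.coe_add, Subalgebra.coe_smul, mul_smul]
      rw [← hus, ← hus, ← hvs, ← hvs, ← hesmul]
      simp only [Algebra.smul_def, map_mul, map_add, map_sub]
      field_simp
      ring
    have hP : P (ℓ • b) = u • P b + (e * v) • Q b := by rw [← hx, hPfix]
    have hQ : Q (ℓ • b) = v • P b + u • Q b := by rw [← hx, hQfix]
    simp only [f, hP, hQ, map_add, map_smul, Subalgebra.coe_add, Subalgebra.coe_smul, mul_smul]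
    rw [← hus', ← hus', ← hvs', ← hvs', ← hesmul']
    conv_rhs => rw [← hℓ]
    simp only [Algebra.smul_def, map_mul, map_add, map_sub]
    field_simp
    ring
  -- assemble the `L`-algebra hom
  let Ψ : B →ₐ[L] B' :=
    { toFun := f
      map_one' := hf_one
      map_mul' := hf_mul
      map_zero' := by
        have h := hf_add 0 0
        rw [add_zero] at h
        have h' : f 0 + f 0 = f 0 + 0 := by rw [add_zero]; exact h.symm
        exact add_left_cancel h' 
      map_add' := hf_add
      commutes' := fun ℓ => by
        rw [Algebra.algebraMap_eq_smul_one, hf_smul, hf_one, Algebra.algebraMap_eq_smul_one] }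
  refine ⟨Ψ, fun b => rfl, fun b => ?_, fun x => ?_⟩
  · -- `Ψ (τ b) = τ' (Ψ b)`: parts of `τ b` are `(P b, −Q b)`
    have hPb : τ (P b : B) = (P b : B) := (P b).2
    have hQb : τ (Q b : B) = (Q b : B) := (Q b).2
    have hx : ((P b : ↥(AlgHom.equalizer (τ : B →ₐ[F] B) (AlgHom.id F B))) : B) + ε • ((-Q b : ↥(AlgHom.equalizer (τ : B →ₐ[F] B) (AlgHom.id F B))) : B) = τ b := by
      conv_rhs => rw [← hPQ b]
      rw [map_add, hPb, hτ ε (Q b : B), hε, hQb, Subalgebra.coe_neg, smul_neg, neg_smul]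
    have hP : P (τ b) = P b := by rw [← hx, hPfix]
    have hQ : Q (τ b) = -Q b := by rw [← hx, hQfix]
    show f (τ b) = τ' (f b)
    simp only [f, hP, hQ, map_neg, map_add, hτ', hε, Subalgebra.coe_neg, hψfix, smul_neg, neg_smul]
  · -- extension of `ψ₀`: parts of `x ∈ K` are `(x, 0)`
    have hx : ((x : ↥(AlgHom.equalizer (τ : B →ₐ[F] B) (AlgHom.id F B))) : B) + ε • ((0 : ↥(AlgHom.equalizer (τ : B →ₐ[F] B) (AlgHom.id F B))) : B) = x := by simp
    have hP : P x = x := by rw [← hx, hPfix]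
    have hQ : Q x = 0 := by rw [← hx, hQfix]
    show f x = ψ₀ x
    simp only [f, hP, hQ, map_zero, Subalgebra.coe_zero, smul_zero, add_zero]

/-- **DESCENT: an `F`-isomorphism of the fixed algebras extends to an `L`-isomorphism intertwining the involutions.**  For commutative `L`-algebras `B, B′` with
`σ`-semilinear `F`-algebra involutions `τ, τ′` (`[L : F] = 2` in the form: fixed field `F`, `2 ≠ 0`, `σ ≠ 1`) and `ψ₀ : B^τ ≃ₐ[F] B′^{τ′}` there is `Ψ : B ≃ₐ[L] B′` with
`Ψ ∘ τ = τ′ ∘ Ψ` and `Ψ|_{B^τ} = ψ₀`. [cite: Rogawski1990, §3.5 p. 29; §3.6 p. 31] -/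
theorem exists_algEquiv_extending_fixed_algEquiv (hσσ : ∀ x : L, σ (σ x) = x)
    (hFix : ∀ x : L, σ x = x → ∃ q : F, algebraMap F L q = x) (h2 : (2 : L) ≠ 0) (hex : ∃ ℓ : L, σ ℓ ≠ ℓ)
    (hτ : ∀ (ℓ : L) (b : B), τ (ℓ • b) = σ ℓ • τ b) (hττ : ∀ b : B, τ (τ b) = b)
    (hτ' : ∀ (ℓ : L) (b : B'), τ' (ℓ • b) = σ ℓ • τ' b) (hττ' : ∀ b : B', τ' (τ' b) = b)
    (ψ₀ : ↥(AlgHom.equalizer (τ : B →ₐ[F] B) (AlgHom.id F B)) ≃ₐ[F] ↥(AlgHom.equalizer (τ' : B' →ₐ[F] B') (AlgHom.id F B'))) :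
    ∃ Ψ : B ≃ₐ[L] B', (∀ b : B, Ψ (τ b) = τ' (Ψ b)) ∧
      ∀ x : ↥(AlgHom.equalizer (τ : B →ₐ[F] B) (AlgHom.id F B)), Ψ (x : B) = (ψ₀ x : B') := by
  obtain ⟨ε, hε0, hε⟩ := exists_ne_zero_map_eq_neg σ hσσ hex
  obtain ⟨Φ, hΦf, hΦτ, hΦx⟩ := exists_algHom_extending_fixed_algHom σ τ τ' hσσ hFix h2 hε0 hε hτ hττ hτ' (ψ₀ : _ →ₐ[F] _)
  obtain ⟨Φ', hΦ'f, -, hΦ'x⟩ := exists_algHom_extending_fixed_algHom σ τ' τ hσσ hFix h2 hε0 hε hτ' hττ' hτ (ψ₀.symm : _ →ₐ[F] _)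
  -- `Φ' ∘ Φ = id` and `Φ ∘ Φ' = id` on `x + ε y`
  have h1 : ∀ b : B, Φ' (Φ b) = b := by
    intro b
    obtain ⟨x, hx⟩ : ∃ x : ↥(AlgHom.equalizer (τ : B →ₐ[F] B) (AlgHom.id F B)), (x : B) = (2 : L)⁻¹ • (b + τ b) :=
      ⟨⟨_, tau_half_add σ τ hτ hττ b⟩, rfl⟩
    obtain ⟨y, hy⟩ : ∃ y : ↥(AlgHom.equalizer (τ : B →ₐ[F] B) (AlgHom.id F B)), (y : B) = (2 * ε)⁻¹ • (b - τ b) :=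
      ⟨⟨_, tau_half_sub σ τ hτ hττ hε b⟩, rfl⟩
    have hb : b = (x : B) + ε • (y : B) := by rw [hx, hy, half_add_add_eps_smul τ h2 hε0 b]
    rw [hb, map_add, map_smul, hΦx, hΦx, map_add, map_smul, hΦ'x, hΦ'x]
    simp
  have h2' : ∀ b : B', Φ (Φ' b) = b := by
    intro b
    obtain ⟨x, hx⟩ : ∃ x : ↥(AlgHom.equalizer (τ' : B' →ₐ[F] B') (AlgHom.id F B')), (x : B') = (2 : L)⁻¹ • (b + τ' b) :=
      ⟨⟨_, tau_half_add σ τ' hτ' hττ' b⟩, rfl⟩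
    obtain ⟨y, hy⟩ : ∃ y : ↥(AlgHom.equalizer (τ' : B' →ₐ[F] B') (AlgHom.id F B')), (y : B') = (2 * ε)⁻¹ • (b - τ' b) :=
      ⟨⟨_, tau_half_sub σ τ' hτ' hττ' hε b⟩, rfl⟩
    have hb : b = (x : B') + ε • (y : B') := by rw [hx, hy, half_add_add_eps_smul τ' h2 hε0 b]
    rw [hb, map_add, map_smul, hΦ'x, hΦ'x, map_add, map_smul, hΦx, hΦx]
    simp
  exact ⟨AlgEquiv.ofAlgHom Φ Φ' (AlgHom.ext h2') (AlgHom.ext h1), fun b => hΦτ b, fun x => hΦx x⟩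

end Main

end Literature.NumberTheory.Rogawski1990
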